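import Summits.QuantumFields.YangMills.Theorems.UnitScaleTiltProp7SymAvgRelativeDiff
import Literature.MathematicalPhysics.QuantumFieldTheory.Balaban1983to89.B12Average012Analytic
import HarnessLib

/-!
# Route `UnitScaleTilt`, crux K1 child «MinimiserStabilityRegPr» (stmt-QuantumFields-19200), stub `stub_existenceMinimalOrbit` (EX), route (α), node (AVG-SYM) —
# (AVG-SYM-AN) IN THE `AnalyticAt` CURRENCY: **the relative k-fold (0.4) average `A ↦ Ū^{(k)}[e^{iηA}U₀♭](e)·(Ū^{(k)}[U₀♭](e))⁻¹` is ANALYTIC (not only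
# ℂ-differentiable) at every complex `A₀` of the small sup-ball, at a curved plaquette-small background** — the input ★w2-20520 g2's Schwarz reduction
# `Prop7AnalyticRemainderInputs.inputs_linRemainder_of_analyticOnNhd_of_bound` (p599231) asks for (`AnalyticOnNhd`, needed for `Inputs.contDiff`; Mathlib has
# «ℂ-differentiable on an open set ⇒ analytic» ONLY for one complex variable, `DifferentiableOn.analyticOnNhd {f : ℂ → E}`, so the `DifferentiableAt` currency of
# `Prop8ChartDiff*` ∕ `Prop7SymAvgRelativeDiff` does not suffice for a Banach-space domain)

Cell `ym3-torus`, width seat `ym-ust-20520-w4` (gen 2; OWNER ym3-torus-plan g25 03:23:51Z «FILE 2 `inputs_CmapSym` IS YOURS»; this file is its analytic half).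
YM₃ on T³ is a ladder rung (R3), NOT the Clay problem; nothing here is a claim about the stub, the crux, d = 4 or the mass gap.  `--supports stmt-QuantumFields-19200
--as helper`; count-neutral.

THE PRINT.  [Balaban1987RG1] p. 253: *«It is a Gᶜ-valued function … we assume that it is an analytic function»*; [Balaban1985Averaging] (11)–(12) p. 19, Prop. 4 p. 38.

WHAT THIS FILE PROVES (sorry-free; no definition; the `Prop8ChartDiff*` ∕ `Prop7SymAvgRelativeDiff` chain re-run with `AnalyticAt` in place of `DifferentiableAt` —
finite products (`AnalyticAt.mul`), inverses of units (`analyticAt_inverse`), `exp` (`NormedSpace.exp_analytic`), print's `exp[mean log]` (`ExpMeanLog.analyticAt_eml`)).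
* §1 (inverses: `B12Average012Analytic.analyticAt_units_inv`, reused) `analyticAt_coe_holT_of_steps`, `analyticAt_coe_emlAvgU_of_twoBlock` (the analytic twin of `Prop8Chart.differentiableAt_coe_emlAvgU_of_twoBlock`),
  `analyticAt_coe_expCfg`, `analyticAt_coe_gaugeActT_mul`.
* §2 ★`analyticAt_coe_emlIterU_family_of_reads` — any bondwise-ANALYTIC family `F : E → GaugeField P 0 𝔸ˣ` with reads ≤ s₀ under the i-blocks of S and the budget
  `6400ℓ²Lⁱs₀ ≤ 1`: `x ↦ Ū^{(i)}[F x](e)` is analytic at `x₀` (induction, `Prop8Chart.norm_emlIterU_sub_one_le_of_reads`, `norm_loopHolU_sub_one_lt_one`).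
* §3 (𝔸 = M₂(ℂ), SU(2) background) ★★**`analyticAt_relIter_of_plaqSmall`** — same hypotheses as `differentiableAt_relIter_of_plaqSmall` (p600621), conclusion `AnalyticAt ℂ`:
  cluster axial gauge (`IterPlaqSmallAllL.dist1_axial_cluster_le`), §2 at the gauged family, `coe_emlIterU_eq_conj_gauged` to undo the gauge.
HONEST SCOPE.  Bookkeeping; every estimate is the `Prop8Chart*` lineage's.

References: T. Bałaban, CMP **109** (1987) 249–301 [Balaban1987RG1] ((0.4)–(0.11) p.253, (0.21) p.256); CMP **98** (1985) 17–51 [Balaban1985Averaging]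
((9) p.18, (11)–(12) p.19, Prop. 4 (134)–(135) p.38); CMP **102** (1985) 277–309 [Balaban1985Variational] ((152) p.301).
-/

noncomputable section

open scoped BigOperators
open NormedSpace

namespace Summit.QuantumFields.YangMills.Theorems.Prop7SymAvgRelativeBound

open Literature.MathematicalPhysics.QuantumFieldTheory.Balaban1983to89
open T4Continuum BlockAveraging AveragingRT ExpMeanLog
open B5Eq118OneStroke (iterBlockOf iterBlockOf_succ iterBlockOf_zero)
open B15DeterminingSets (embIter)
open B12Average012Analytic (analyticAt_units_inv)
open B10Eq27TorusAxialLog (holT holT_nil holT_cons_true holT_cons_false axialT gaugeActT gaugeActT_apply unitsField toUField suIncl)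
open Summit.QuantumFields.YangMills.Theorems.Prop8Chart (expCfg coe_expCfg loopHolU emlAvgU coe_emlAvgU emlIterU emlIterU_zero emlIterU_succ
  norm_emlIterU_sub_one_le_of_reads coe_unitsField_toUField norm_loopHolU_sub_one_lt_one two_block_of_mem_loopWalk exists_eq_line_of_mem_walk)
open Summit.QuantumFields.YangMills.Theorems.IterPlaqSmallAllL (dist1_axial_cluster_le)

variable {P : Params}

/-! ## §1 The analytic toolkit -/

section Generic

variable {j : ℕ}
variable {𝔸 : Type*} [NormedRing 𝔸] [NormedAlgebra ℂ 𝔸] [CompleteSpace 𝔸] [NormOneClass 𝔸]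
variable {E : Type*} [NormedAddCommGroup E] [NormedSpace ℂ E]

omit [NormOneClass 𝔸] in
/-- **A TRANSPORT IS ANALYTIC IN THE PARAMETER AS SOON AS THE BOND VARIABLES ON ITS WALK ARE.** [cite: Balaban1985Averaging, (9) p.18] -/
theorem analyticAt_coe_holT_of_steps {F : E → GaugeField P j 𝔸ˣ} {x₀ : E} :
    ∀ (w : List (Letter P.d)) (y : Site P j),
      (∀ st ∈ walk y w, AnalyticAt ℂ (fun x => ((F x st.bond : 𝔸ˣ) : 𝔸)) x₀) →
      AnalyticAt ℂ (fun x => ((holT (F x) y w : 𝔸ˣ) : 𝔸)) x₀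
  | [], y, _ => by simpa [holT_nil] using analyticAt_const
  | (μ, true) :: w, y, h => by
    have ih := analyticAt_coe_holT_of_steps w (y.shift μ) fun st hst => h st (by simp [walk, hst])
    have hb := h ⟨⟨y, μ⟩, true⟩ (by simp [walk])
    have hfun : (fun x => ((holT (F x) y ((μ, true) :: w) : 𝔸ˣ) : 𝔸)) =
        fun x => ((F x ⟨y, μ⟩ : 𝔸ˣ) : 𝔸) * ((holT (F x) (y.shift μ) w : 𝔸ˣ) : 𝔸) := by
      funext x; rw [holT_cons_true, Units.val_mul]
    rw [hfun]
    exact hb.mul ih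
  | (μ, false) :: w, y, h => by
    have ih := analyticAt_coe_holT_of_steps w (y.unshift μ) fun st hst => h st (by simp [walk, hst])
    have hb := h ⟨⟨y.unshift μ, μ⟩, false⟩ (by simp [walk])
    have hfun : (fun x => ((holT (F x) y ((μ, false) :: w) : 𝔸ˣ) : 𝔸)) =
        fun x => (((F x ⟨y.unshift μ, μ⟩)⁻¹ : 𝔸ˣ) : 𝔸) * ((holT (F x) (y.unshift μ) w : 𝔸ˣ) : 𝔸) := by
      funext x; rw [holT_cons_false, Units.val_mul]
    rw [hfun]
    exact (analyticAt_units_inv hb).mul ih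

omit [NormOneClass 𝔸] in
/-- **LOCAL ANALYTICITY OF THE UNGUARDED (0.4) AVERAGE** (the analytic twin of `Prop8Chart.differentiableAt_coe_emlAvgU_of_twoBlock`): if the bond variables of
`F x` on the two-block bonds of `c` are analytic at `x₀` and the loop variables of `F x₀` at `c` are within `1` of `1`, then `x ↦ (emlAvgU (F x))(c)` is analytic
at `x₀` (`ExpMeanLog.analyticAt_eml`). [cite: Balaban1987RG1, (0.4) p.253] -/
theorem analyticAt_coe_emlAvgU_of_twoBlock (hj : j + 1 ≤ P.m + P.K) {F : E → GaugeField P j 𝔸ˣ} {x₀ : E} (c : PBond P (j + 1))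
    (hF : ∀ b : PBond P j, (blockOf b.src = c.src ∨ blockOf b.src = c.tgt) → (blockOf b.tgt = c.src ∨ blockOf b.tgt = c.tgt) →
      AnalyticAt ℂ (fun x => ((F x b : 𝔸ˣ) : 𝔸)) x₀)
    (hloop : ∀ i : Idx P, ‖((loopHolU (F x₀) c i : 𝔸ˣ) : 𝔸) - 1‖ < 1) :
    AnalyticAt ℂ (fun x => ((emlAvgU (F x) c : 𝔸ˣ) : 𝔸)) x₀ := by
  have h : (fun x => ((emlAvgU (F x) c : 𝔸ˣ) : 𝔸)) = fun x =>
      eml (fun i : Idx P => ((loopHolU (F x) c i : 𝔸ˣ) : 𝔸)) * ((holT (F x) (emb c.src) (List.replicate P.L (c.dir, true)) : 𝔸ˣ) : 𝔸) := by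
    funext x; exact coe_emlAvgU (F x) c
  rw [h]
  refine AnalyticAt.mul ?_ (analyticAt_coe_holT_of_steps _ _ fun st hst => ?_)
  · have hfam : AnalyticAt ℂ (fun x => fun i : Idx P => ((loopHolU (F x) c i : 𝔸ˣ) : 𝔸)) x₀ :=
      analyticAt_pi_iff.mpr fun i => by
        unfold loopHolU
        exact analyticAt_coe_holT_of_steps _ _ fun st hst =>
          hF st.bond (two_block_of_mem_loopWalk hj c i hst).1 (two_block_of_mem_loopWalk hj c i hst).2
    exact AnalyticAt.comp_of_eq (analyticAt_eml hloop) hfam rfl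
  · obtain ⟨t, ht, hb⟩ := exists_eq_line_of_mem_walk c hst
    rw [hb]
    exact hF (line c t) (blockOf_lineSite hj c ht) (T4ReflectionConeSharp.blockOf_tgt_line hj c ht)

omit [NormOneClass 𝔸] in
/-- The charted bond variable `e^{iηA(b)}` is analytic in `A` (everywhere: `exp` of a continuous linear functional). [cite: Balaban1985Variational, (152) p.301] -/
theorem analyticAt_coe_expCfg (η : ℝ) (b : PBond P 0) (A₀ : PBond P 0 → 𝔸) :
    AnalyticAt ℂ (fun A : PBond P 0 → 𝔸 => ((expCfg η A b : 𝔸ˣ) : 𝔸)) A₀ := by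
  have h : (fun A : PBond P 0 → 𝔸 => ((expCfg η A b : 𝔸ˣ) : 𝔸)) = fun A => exp ((Complex.I * (η : ℂ)) • A b) := by
    funext A; exact coe_expCfg η A b
  rw [h]
  have hproj : AnalyticAt ℂ (fun A : PBond P 0 → 𝔸 => A b) A₀ :=
    (ContinuousLinearMap.proj (R := ℂ) (φ := fun _ : PBond P 0 => 𝔸) b).analyticAt A₀
  have hsm : AnalyticAt ℂ (fun A : PBond P 0 → 𝔸 => (Complex.I * (η : ℂ)) • A b) A₀ :=
    ((Complex.I * (η : ℂ)) • ContinuousLinearMap.proj (R := ℂ) (φ := fun _ : PBond P 0 => 𝔸) b).analyticAt A₀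
  exact AnalyticAt.comp_of_eq (exp_analytic _) hsm rfl

omit [NormOneClass 𝔸] in
/-- **BONDWISE ANALYTICITY OF THE GAUGED PERTURBED FAMILY** `A ↦ (e^{iηA}·V)^{û}(b) = û(b₋)·e^{iηA(b)}·V(b)·û(b₊)⁻¹`. [cite: Balaban1985Averaging, (8) p.19] -/
theorem analyticAt_coe_gaugeActT_mul (û : GaugeTransf P 0 𝔸ˣ) (η : ℝ) (V : GaugeField P 0 𝔸ˣ) (b : PBond P 0) (A₀ : PBond P 0 → 𝔸) :
    AnalyticAt ℂ (fun A : PBond P 0 → 𝔸 => ((gaugeActT û (fun b => expCfg η A b * V b) b : 𝔸ˣ) : 𝔸)) A₀ := by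
  have h : (fun A : PBond P 0 → 𝔸 => ((gaugeActT û (fun b => expCfg η A b * V b) b : 𝔸ˣ) : 𝔸)) =
      fun A => ((û b.src : 𝔸ˣ) : 𝔸) * ((expCfg η A b : 𝔸ˣ) : 𝔸) * (((V b : 𝔸ˣ) : 𝔸) * (((û b.tgt)⁻¹ : 𝔸ˣ) : 𝔸)) := by
    funext A; rw [gaugeActT_apply]; simp only [Units.val_mul]; noncomm_ring
  rw [h]
  exact (analyticAt_const.mul (analyticAt_coe_expCfg η b A₀)).mul analyticAt_const

/-! ## §2 The iterated average of an analytic family with small reads -/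

/-- **`x ↦ Ū^{(i)}[F x](e)` IS ANALYTIC AT EVERY `x₀` WHERE THE FAMILY IS BONDWISE ANALYTIC AND ITS BONDS ARE WITHIN `s₀` OF `1` UNDER THE TWO BLOCKS OF `e`**
(budget `6400ℓ²Lⁱs₀ ≤ 1`; the analytic twin of `differentiableAt_coe_emlIterU_family_of_reads`). [cite: Balaban1987RG1, (0.4) p.253, (0.21) p.256] -/
theorem analyticAt_coe_emlIterU_family_of_reads (F : E → GaugeField P 0 𝔸ˣ) (x₀ : E)
    (hF0 : ∀ b : PBond P 0, AnalyticAt ℂ (fun x => ((F x b : 𝔸ˣ) : 𝔸)) x₀) :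
    ∀ (i : ℕ), i ≤ P.m + P.K → ∀ (S : Set (Site P i)) (s₀ : ℝ), 0 ≤ s₀ →
      6400 * (((P.d + 2) * P.L : ℕ) : ℝ) ^ 2 * (P.L : ℝ) ^ i * s₀ ≤ 1 →
      (∀ b : PBond P 0, iterBlockOf i b.src ∈ S → iterBlockOf i b.tgt ∈ S → ‖((F x₀ b : 𝔸ˣ) : 𝔸) - 1‖ ≤ s₀) →
      ∀ e : PBond P i, e.src ∈ S → e.tgt ∈ S →
        AnalyticAt ℂ (fun x : E => ((emlIterU i (F x) e : 𝔸ˣ) : 𝔸)) x₀ := by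
  set ℓ : ℝ := (((P.d + 2) * P.L : ℕ) : ℝ) with hℓ
  have hℓ1 : (1 : ℝ) ≤ ℓ := by
    rw [hℓ]; exact_mod_cast Nat.one_le_iff_ne_zero.mpr (Nat.mul_ne_zero (by omega) (by have := P.hL.2; omega))
  have hℓ0 : (0 : ℝ) ≤ ℓ := by linarith
  have hL1 : (1 : ℝ) ≤ P.L := by exact_mod_cast P.L_pos
  intro i
  induction i with
  | zero =>
    intro _ S s₀ _ _ _ e _ _
    simpa only [emlIterU_zero] using hF0 e
  | succ i ih =>
    intro hi S s₀ hs₀ hbudget hA c hcs hct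
    have hbudget_i : 6400 * ℓ ^ 2 * (P.L : ℝ) ^ i * s₀ ≤ 1 := by
      refine le_trans ?_ hbudget
      have : (P.L : ℝ) ^ i ≤ (P.L : ℝ) ^ (i + 1) := pow_le_pow_right₀ hL1 (Nat.le_succ i)
      have h0 : 0 ≤ 6400 * ℓ ^ 2 * s₀ := by positivity
      nlinarith
    set S' : Set (Site P i) := {y | blockOf y ∈ S} with hS'
    have hA' : ∀ b : PBond P 0, iterBlockOf i b.src ∈ S' → iterBlockOf i b.tgt ∈ S' → ‖((F x₀ b : 𝔸ˣ) : 𝔸) - 1‖ ≤ s₀ :=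
      fun b hs ht => hA b (by rw [iterBlockOf_succ]; exact hs) (by rw [iterBlockOf_succ]; exact ht)
    have hF : ∀ e : PBond P i, e.src ∈ S' → e.tgt ∈ S' →
        AnalyticAt ℂ (fun x : E => ((emlIterU i (F x) e : 𝔸ˣ) : 𝔸)) x₀ :=
      ih (Nat.le_of_succ_le hi) S' s₀ hs₀ hbudget_i hA'
    have hnear : ∀ e : PBond P i, e.src ∈ S' → e.tgt ∈ S' →
        ‖((emlIterU i (F x₀) e : 𝔸ˣ) : 𝔸) - 1‖ ≤ 30 * ℓ * (P.L : ℝ) ^ i * s₀ :=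
      fun e hs ht => norm_emlIterU_sub_one_le_of_reads (Nat.le_of_succ_le hi) S' (F x₀) hs₀ hbudget_i hA' e hs ht
    have hfun : (fun x : E => ((emlIterU (i + 1) (F x) c : 𝔸ˣ) : 𝔸)) = fun x => ((emlAvgU (emlIterU i (F x)) c : 𝔸ˣ) : 𝔸) := by
      funext x; rw [emlIterU_succ]
    rw [hfun]
    have hmem : ∀ b : PBond P i, (blockOf b.src = c.src ∨ blockOf b.src = c.tgt) → (blockOf b.tgt = c.src ∨ blockOf b.tgt = c.tgt) →
        b.src ∈ S' ∧ b.tgt ∈ S' := by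
      intro b hbs hbt
      constructor
      · show blockOf b.src ∈ S
        rcases hbs with h | h <;> rw [h]
        exacts [hcs, hct]
      · show blockOf b.tgt ∈ S
        rcases hbt with h | h <;> rw [h]
        exacts [hcs, hct]
    refine analyticAt_coe_emlAvgU_of_twoBlock (F := fun x : E => emlIterU i (F x)) hi c
      (fun b hbs hbt => hF b (hmem b hbs hbt).1 (hmem b hbs hbt).2) ?_
    have h30 : 0 ≤ 30 * ℓ * (P.L : ℝ) ^ i * s₀ := by positivity
    have hlt : 4 * (((P.d + 2) * P.L : ℕ) : ℝ) * (30 * ℓ * (P.L : ℝ) ^ i * s₀) < 1 := by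
      rw [← hℓ]
      have : 4 * ℓ * (30 * ℓ * (P.L : ℝ) ^ i * s₀) = (120 / 6400) * (6400 * ℓ ^ 2 * (P.L : ℝ) ^ i * s₀) := by ring
      rw [this]; nlinarith
    exact norm_loopHolU_sub_one_lt_one hi c h30 hlt fun b hbs hbt => hnear b (hmem b hbs hbt).1 (hmem b hbs hbt).2

end Generic

/-! ## §3 The SU(2) background: analyticity of the relative iterate -/

section SU2

open scoped Matrix.Norms.L2Operator

/-- ★★ **(AVG-SYM-AN), ANALYTIC CURRENCY — THE RELATIVE k-FOLD (0.4) AVERAGE IS ANALYTIC AT EVERY POINT OF THE k-UNIFORM SUP-BALL AT A CURVED,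
PLAQUETTE-SMALL SU(2) BACKGROUND.**  Same hypotheses as `differentiableAt_relIter_of_plaqSmall`; conclusion
`AnalyticAt ℂ (A ↦ Ū^{(k)}[e^{iηA}·U₀♭](e)·(Ū^{(k)}[U₀♭](e))⁻¹) A₀`. [cite: Balaban1987RG1, (0.4) p.253, (0.21) p.256; Balaban1985Averaging, (11)-(12) p.19, Prop. 4 (134)-(135) p.38] -/
theorem analyticAt_relIter_of_plaqSmall {k : ℕ} (hk : k + 1 ≤ P.m + P.K) (U₀ : GaugeField P 0 (Matrix.specialUnitaryGroup (Fin 2) ℂ))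
    {a₀ : ℝ} (ha₀ : 0 < a₀) (hU : PlaqSmall a₀ U₀) (η : ℝ) (A₀ : PBond P 0 → Matrix (Fin 2) (Fin 2) ℂ) {t : ℝ} (ht1 : t ≤ 1)
    (hA : ∀ b, ‖(η : ℂ) • A₀ b‖ ≤ t)
    (hbudget : 6400 * (((P.d + 2) * P.L : ℕ) : ℝ) ^ 2 * (P.L : ℝ) ^ k *
      (2 * t * (1 + 2 * ((P.d : ℝ) * (3 * (P.L : ℝ) ^ k - 1)) * a₀) + 2 * ((P.d : ℝ) * (3 * (P.L : ℝ) ^ k - 1)) * a₀) ≤ 1)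
    (e : PBond P k) :
    AnalyticAt ℂ (fun A : PBond P 0 → Matrix (Fin 2) (Fin 2) ℂ =>
      ((emlIterU k (fun b => expCfg η A b * unitsField (toUField U₀) b) e : (Matrix (Fin 2) (Fin 2) ℂ)ˣ) : Matrix (Fin 2) (Fin 2) ℂ) *
        (((emlIterU k (unitsField (toUField U₀)) e)⁻¹ : (Matrix (Fin 2) (Fin 2) ℂ)ˣ) : Matrix (Fin 2) (Fin 2) ℂ)) A₀ := by
  set sB : ℝ := 2 * ((P.d : ℝ) * (3 * (P.L : ℝ) ^ k - 1)) * a₀ with hsB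
  set s₀ : ℝ := 2 * t * (1 + sB) + sB with hs₀
  set z := e.src with hz
  set u : GaugeTransf P 0 (Matrix.specialUnitaryGroup (Fin 2) ℂ) := axialT U₀ (embIter k z) with hu
  set û : GaugeTransf P 0 (Matrix (Fin 2) (Fin 2) ℂ)ˣ := fun x => Unitary.toUnits (suIncl (u x)) with hû
  set V₂ : GaugeField P 0 (Matrix (Fin 2) (Fin 2) ℂ)ˣ := unitsField (toUField U₀) with hV₂
  have ht0 : 0 ≤ t := (norm_nonneg _).trans (hA ⟨embIter k e.src, e.dir⟩)
  have hL1 : (1 : ℝ) ≤ P.L := by exact_mod_cast P.L_pos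
  have hsB0 : 0 ≤ sB := by
    rw [hsB]
    have h3 : (0 : ℝ) ≤ 3 * (P.L : ℝ) ^ k - 1 := by linarith [one_le_pow₀ (n := k) hL1]
    positivity
  have hs₀0 : 0 ≤ s₀ := by rw [hs₀]; positivity
  set S : Set (Site P k) := {w | w = z ∨ w = z.shift e.dir ∨ w = z.shift e.dir ∨ w = (z.shift e.dir).shift e.dir} with hS
  have hsrc : e.src ∈ S := Or.inl hz.symm
  have htgt : e.tgt ∈ S := Or.inr (Or.inl rfl)
  have hreads₂ : ∀ b : PBond P 0, iterBlockOf k b.src ∈ S → iterBlockOf k b.tgt ∈ S →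
      ‖((gaugeActT û V₂ b : (Matrix (Fin 2) (Fin 2) ℂ)ˣ) : Matrix (Fin 2) (Fin 2) ℂ) - 1‖ ≤ sB := by
    intro b hbs hbt
    rw [hû, hV₂, ← unitsField_toUField_gaugeActT, coe_unitsField_toUField, ← SU2Mean.dist1_eq_norm, hu]
    exact dist1_axial_cluster_le hk U₀ ha₀ hU z e.dir e.dir b hbs hbt
  have hE : ∀ b : PBond P 0, ‖((expCfg η A₀ b : (Matrix (Fin 2) (Fin 2) ℂ)ˣ) : Matrix (Fin 2) (Fin 2) ℂ) - 1‖ ≤ 2 * t := by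
    intro b
    have hI : ‖(Complex.I * (η : ℂ)) • A₀ b‖ = ‖(η : ℂ) • A₀ b‖ := by rw [mul_smul, norm_smul, Complex.norm_I, one_mul]
    rw [coe_expCfg]
    calc _ ≤ 2 * ‖(Complex.I * (η : ℂ)) • A₀ b‖ := B7TransferAnalyticMean.norm_exp_sub_one_le_two_mul (by rw [hI]; exact (hA b).trans ht1)
      _ ≤ 2 * t := by rw [hI]; linarith [hA b]
  have hreads₁ : ∀ b : PBond P 0, iterBlockOf k b.src ∈ S → iterBlockOf k b.tgt ∈ S →
      ‖((gaugeActT û (fun b => expCfg η A₀ b * V₂ b) b : (Matrix (Fin 2) (Fin 2) ℂ)ˣ) : Matrix (Fin 2) (Fin 2) ℂ) - 1‖ ≤ s₀ := by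
    intro b hbs hbt
    rw [hs₀]
    exact norm_reads_gauged_product_le u (expCfg η A₀) V₂ b (hE b) (hreads₂ b hbs hbt)
  have hbud : 6400 * (((P.d + 2) * P.L : ℕ) : ℝ) ^ 2 * (P.L : ℝ) ^ k * s₀ ≤ 1 := hbudget
  have han : AnalyticAt ℂ (fun A : PBond P 0 → Matrix (Fin 2) (Fin 2) ℂ =>
      ((emlIterU k (gaugeActT û (fun b => expCfg η A b * V₂ b)) e : (Matrix (Fin 2) (Fin 2) ℂ)ˣ) : Matrix (Fin 2) (Fin 2) ℂ)) A₀ :=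
    analyticAt_coe_emlIterU_family_of_reads (fun A : PBond P 0 → Matrix (Fin 2) (Fin 2) ℂ => gaugeActT û (fun b => expCfg η A b * V₂ b)) A₀
      (fun b => analyticAt_coe_gaugeActT_mul û η V₂ b A₀) k (Nat.le_of_succ_le hk) S s₀ hs₀0 hbud hreads₁ e hsrc htgt
  have hfun : (fun A : PBond P 0 → Matrix (Fin 2) (Fin 2) ℂ =>
      ((emlIterU k (fun b => expCfg η A b * V₂ b) e : (Matrix (Fin 2) (Fin 2) ℂ)ˣ) : Matrix (Fin 2) (Fin 2) ℂ) *
        (((emlIterU k V₂ e)⁻¹ : (Matrix (Fin 2) (Fin 2) ℂ)ˣ) : Matrix (Fin 2) (Fin 2) ℂ)) =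
      fun A => (((transfUp û k e.src)⁻¹ : (Matrix (Fin 2) (Fin 2) ℂ)ˣ) : Matrix (Fin 2) (Fin 2) ℂ) *
        ((emlIterU k (gaugeActT û (fun b => expCfg η A b * V₂ b)) e : (Matrix (Fin 2) (Fin 2) ℂ)ˣ) : Matrix (Fin 2) (Fin 2) ℂ) *
        (((transfUp û k e.tgt : (Matrix (Fin 2) (Fin 2) ℂ)ˣ) : Matrix (Fin 2) (Fin 2) ℂ) *
          (((emlIterU k V₂ e)⁻¹ : (Matrix (Fin 2) (Fin 2) ℂ)ˣ) : Matrix (Fin 2) (Fin 2) ℂ)) := by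
    funext A
    rw [coe_emlIterU_eq_conj_gauged û (fun b => expCfg η A b * V₂ b) k e, mul_assoc]
  rw [hfun]
  exact (analyticAt_const.mul han).mul analyticAt_const

end SU2

end Summit.QuantumFields.YangMills.Theorems.Prop7SymAvgRelativeBound

end
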